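import Literature.NumberTheory.EllipticCurves.PAdicLFunctionTameEulerFactorSeriesProofs
import Literature.NumberTheory.EllipticCurves.PAdicLFunctionTameDepletionFactorProofs
import Literature.NumberTheory.EllipticCurves.PAdicLFunctionTameIntegralityAtTwoProofs
import Literature.NumberTheory.EllipticCurves.IsogenyFrobeniusTraceProofs
import HarnessLib

/-!
# The `m`-DEPLETED `2`-adic `L`-function is congruent to `L₂(E) · ∏_{ℓ | m} 𝒫_ℓ` modulo `2`, `E[2]` irreducible
# (Matsuno 2000, proof of Thm. 3.1 via Lemma 3.3, at `p = 2`, in Greenberg–Vatsal's currency) (PROOFS ONLY)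

Cell bsd-2adic, seat conv-1 (planner RULING RC-159; the DEPLETION half of the congruence `hcong` of
`Summits/BirchSwinnertonDyer/BirchSwinnertonDyer/Theorems/TwoAdicConverseKidaAnalyticOfCongruence.lean`). For `E = W/ℚ`
globally minimal, good ordinary at `2`, `f` its newform, `ρ̄_{E,2}` irreducible, and a finite set `S₀` of odd places of good
reduction with `m = ∏_{v∈S₀} ℓ_v` (squarefree tame level):

* **`exists_iwasawa_padicLFunctionTame_one_congr_two`** — there are `L_W, G₁ ∈ Λ = ℤ₂⟦T⟧` and a unit `u ∈ Λˣ` with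
  `ι L_W = L₂(f, α)` (`exists_iwasawaToPowerSeries_eq_padicLFunction_two`), `ι G₁ = L₂(f, α, 𝟙_m)` (the `m`-depleted function:
  `G₁ = (∏_ℓ h_ℓ) · L_W`, `h_ℓ = a_ℓ − (1+T)^{−f_ℓ} − (1+T)^{f_ℓ}`, Matsuno's Lemma 3.3 iterated,
  `iwasawaToPowerSeries_prod_tameEulerFactor_mul` with `c_ℓ = f_ℓ` by `exists_teichmuller_frobeniusExponent`) and
  `G₁ ≡ u · L_W · ∏_{v∈S₀} 𝒫_v (mod 2)` (`𝒫_v = GreenbergVatsal2000.eulerFactorElement W 2 v`,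
  `map_toZMod_eulerFactorElement_two_eq`: `𝒫_ℓ ≡ −(1+T)^{f_ℓ} h_ℓ`, `u = ∏ (−(1+T)^{−f_ℓ})`).

With the character half (`exists_iwasawa_pair_map_toZMod_eq_two`: `L₂(f,α,χ_d) ≡ L₂(f,α,𝟙_d) (mod 2)`) this leaves, of the
congruence `hcong`, exactly the Birch-lemma identification `L₂(f_{E^{(d)}}, α') = unit · L₂(f, α, χ_d)` (road P4).

References: K. Matsuno, J. Number Theory 84 (2000), Lemma 3.3 and proof of Thm. 3.1 (pp. 87–88) [Matsuno2000];
R. Greenberg, V. Vatsal, Invent. Math. 142 (2000), §1 p. 9 (display (8)), §2 Prop. (2.4) [GreenbergVatsal2000].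
-/

noncomputable section

open scoped Classical MatrixGroups ModularForm

open NumberField IsDedekindDomain WeierstrassCurve CongruenceSubgroup PowerSeries
  Literature.NumberTheory.EllipticCurves.ModularForms Literature.NumberTheory.EllipticCurves.GreenbergVatsal2000

namespace Literature.NumberTheory.EllipticCurves

section DepletionAtTwo

variable {N : ℕ} [NeZero N] {f : CuspForm (Gamma0 N) 2}
  {W : WeierstrassCurve ℚ} [W.IsElliptic] [W.IsGloballyMinimal]

/-- Distinct finite places of `ℚ` lie over distinct primes; private helper. [folklore] -/
private theorem natGenerator_injective_rat :
    Function.Injective (Rat.HeightOneSpectrum.natGenerator (R := 𝓞 ℚ)) := fun _ _ h ↦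
  (Rat.HeightOneSpectrum.primesEquiv (R := 𝓞 ℚ)).injective (Subtype.ext h)

/-- `−(1+T)^{c}` is a unit of `Λ` (`(1+T)^{c} (1+T)^{−c} = 1`); private helper. [folklore] -/
private theorem isUnit_neg_binomialSeries {p : ℕ} [Fact p.Prime] (c : ℤ_[p]) :
    IsUnit (-PowerSeries.binomialSeries ℤ_[p] c) := by
  refine (isUnit_iff_exists_inv.mpr ⟨PowerSeries.binomialSeries ℤ_[p] (-c), ?_⟩).neg
  rw [← PowerSeries.binomialSeries_add, add_neg_cancel, PowerSeries.binomialSeries_zero]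

/-- **The `m`-depleted `2`-adic `L`-function vs `L₂(E) · ∏ 𝒫_ℓ`, modulo `2` (`E[2]` irreducible).** For `E = W/ℚ` globally
minimal, good ordinary at `2`, `f` its newform, `ρ̄_{E,2}` irreducible, `S₀` a finite set of ODD places of GOOD reduction and
`m = ∏_{v∈S₀} ℓ_v`: there are `L_W, G₁ ∈ ℤ₂⟦T⟧` and `u ∈ ℤ₂⟦T⟧ˣ` with `ι L_W = L₂(f,α)`, `ι G₁ = L₂(f,α,𝟙_m)` and
`G₁ mod 2 = (u · L_W · ∏_{v∈S₀} 𝒫_v) mod 2` — Matsuno's Lemma 3.3 iterated (`G₁ = ∏ h_ℓ · L_W`) and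
`𝒫_ℓ ≡ −(1+T)^{f_ℓ} h_ℓ (mod 2)`. [cite: Matsuno2000, Lemma 3.3 and proof of Theorem 3.1 (pp. 87–88)]
[cite: GreenbergVatsal2000, §1 p. 9 (display (8)) and §2 Prop. (2.4)] -/
theorem exists_iwasawa_padicLFunctionTame_one_congr_two (hord : IsOrdinaryAt W 2) (hf : IsNewformOf W f)
    (hirr : W.HasIrreducibleModPGaloisRep 2) (S₀ : Finset (HeightOneSpectrum (𝓞 ℚ)))
    (hS2 : ∀ v ∈ S₀, Rat.HeightOneSpectrum.natGenerator v ≠ 2) (hgood : ∀ v ∈ S₀, W.HasGoodReductionAt v)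
    {m : ℕ} [NeZero m] (hm : m = ∏ v ∈ S₀, Rat.HeightOneSpectrum.natGenerator v) :
    ∃ (LW G₁ : IwasawaAlgebra 2) (u : (IwasawaAlgebra 2)ˣ),
      iwasawaToPowerSeries 2 LW = padicLFunction f (unitRoot W 2 : ℚ_[2]) ∧
      iwasawaToPowerSeries 2 G₁ = padicLFunctionTame f m (unitRoot W 2 : ℚ_[2]) 1 ∧
      PowerSeries.map (PadicInt.toZMod (p := 2)) G₁ =
        PowerSeries.map (PadicInt.toZMod (p := 2)) ((u : IwasawaAlgebra 2) * LW * eulerFactorProduct W 2 S₀) := by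
  obtain ⟨LW, hLW⟩ := exists_iwasawaToPowerSeries_eq_padicLFunction_two hord hf hirr
  obtain ⟨hαeq, hαu, -⟩ := unitRoot_coe_spec (W := W) hord
  have hpN : ¬ 2 ∣ N := not_dvd_level_of_isNewformOf hf hord.1
  have hprime : ∀ v : HeightOneSpectrum (𝓞 ℚ), (Rat.HeightOneSpectrum.natGenerator v).Prime := fun v ↦
    (Rat.HeightOneSpectrum.primesEquiv v).2
  have hcop : ∀ v ∈ S₀, (Rat.HeightOneSpectrum.natGenerator v).Coprime 2 := fun v hv ↦
    (Nat.coprime_primes (hprime v) Nat.prime_two).mpr (hS2 v hv)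
  have hgoodp : ∀ v ∈ S₀, (haveI : Fact (Rat.HeightOneSpectrum.natGenerator v).Prime := ⟨hprime v⟩;
      W.HasGoodReductionAtPrime (Rat.HeightOneSpectrum.natGenerator v)) := fun v hv ↦
    (hasGoodReductionAtPrime_iff_hasGoodReductionAt_ringOfIntegers v W).mpr (hgood v hv)
  -- Teichmüller data `ℓ ≡ ω(ℓ) γ^{f_ℓ}` at every finite level
  set teich : ℕ → rootsOfUnity (torsionOrder 2) ℤ_[2] := fun ℓ ↦
    if h : ℓ.Coprime 2 then Classical.choose (exists_teichmuller_frobeniusExponent 2 h) else 1 with hteich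
  have hc : ∀ ℓ ∈ S₀.image Rat.HeightOneSpectrum.natGenerator, ∀ n : ℕ,
      PadicInt.toZModPow (n + cyclotomicExponent 2) ((teich ℓ : ℤ_[2]ˣ) : ℤ_[2]) *
        (cyclotomicGenerator 2 : ZMod (2 ^ (n + cyclotomicExponent 2))) ^
          (PadicInt.toZModPow n ((fun ℓ : ℕ ↦ frobeniusExponent 2 (ℓ : ℤ_[2])) ℓ)).val =
          (ℓ : ZMod (2 ^ (n + cyclotomicExponent 2))) := by
    intro ℓ hℓ n
    obtain ⟨v, hv, rfl⟩ := Finset.mem_image.mp hℓ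
    have h := hcop v hv
    simp only [hteich, dif_pos h]
    exact Classical.choose_spec (exists_teichmuller_frobeniusExponent 2 h) n
  have hS : ∀ ℓ ∈ S₀.image Rat.HeightOneSpectrum.natGenerator, ℓ.Prime ∧ ¬ ℓ ∣ N ∧ ℓ.Coprime 2 := by
    intro ℓ hℓ
    obtain ⟨v, hv, rfl⟩ := Finset.mem_image.mp hℓ
    haveI : Fact (Rat.HeightOneSpectrum.natGenerator v).Prime := ⟨hprime v⟩
    exact ⟨hprime v, not_dvd_level_of_isNewformOf hf (hgoodp v hv), hcop v hv⟩
  have ha : ∀ ℓ ∈ S₀.image Rat.HeightOneSpectrum.natGenerator, cuspCoeff f ℓ = ((W.frobeniusTrace ℓ : ℤ) : ℂ) := by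
    intro ℓ hℓ
    obtain ⟨v, hv, rfl⟩ := Finset.mem_image.mp hℓ
    haveI : Fact (Rat.HeightOneSpectrum.natGenerator v).Prime := ⟨hprime v⟩
    exact cuspCoeff_eq_frobeniusTrace_of_isNewformOf_holds hf (hgoodp v hv)
  have hinj : ∀ v ∈ S₀, ∀ w ∈ S₀,
      Rat.HeightOneSpectrum.natGenerator v = Rat.HeightOneSpectrum.natGenerator w → v = w :=
    fun v _ w _ h ↦ natGenerator_injective_rat h
  have hm' : m = ∏ ℓ ∈ S₀.image Rat.HeightOneSpectrum.natGenerator, ℓ := by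
    rw [hm, Finset.prod_image hinj]
  have hG₁ := iwasawaToPowerSeries_prod_tameEulerFactor_mul hf.1 hf.coeffField_eq_bot hpN
    (cuspCoeff_eq_frobeniusTrace_of_isNewformOf_holds hf hord.1) hαeq hαu (a := W.frobeniusTrace)
    (teich := teich) (c := fun ℓ : ℕ ↦ frobeniusExponent 2 (ℓ : ℤ_[2])) hS ha hc hm' hLW
  -- the unit `u = ∏ (−(1+T)^{−f_ℓ})`
  set uv : HeightOneSpectrum (𝓞 ℚ) → (IwasawaAlgebra 2)ˣ := fun v ↦
    (isUnit_neg_binomialSeries (-frobeniusExponent 2 (Rat.HeightOneSpectrum.natGenerator v : ℤ_[2]))).unit with huv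
  have huv_val : ∀ v, ((uv v : (IwasawaAlgebra 2)ˣ) : IwasawaAlgebra 2) =
      -PowerSeries.binomialSeries ℤ_[2] (-frobeniusExponent 2 (Rat.HeightOneSpectrum.natGenerator v : ℤ_[2])) :=
    fun v ↦ IsUnit.unit_spec _
  -- per place: `u_v 𝒫_v ≡ h_ℓ (mod 2)`
  have key : ∀ v ∈ S₀, PowerSeries.map (PadicInt.toZMod (p := 2))
      (C ((W.frobeniusTrace (Rat.HeightOneSpectrum.natGenerator v) : ℤ) : ℤ_[2]) -
        PowerSeries.binomialSeries ℤ_[2] (-frobeniusExponent 2 (Rat.HeightOneSpectrum.natGenerator v : ℤ_[2])) -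
        PowerSeries.binomialSeries ℤ_[2] (frobeniusExponent 2 (Rat.HeightOneSpectrum.natGenerator v : ℤ_[2]))) =
      PowerSeries.map (PadicInt.toZMod (p := 2)) ((uv v : IwasawaAlgebra 2) * eulerFactorElement W 2 v) := by
    intro v hv
    have hE := map_toZMod_eulerFactorElement_two_eq W v (hgood v hv) (hcop v hv)
    rw [frobeniusTraceAt_eq_frobeniusTrace] at hE
    rw [map_mul, hE, ← map_mul, huv_val, frobeniusSeries_eq, ← mul_assoc, neg_mul_neg,
      ← PowerSeries.binomialSeries_add, neg_add_cancel, PowerSeries.binomialSeries_zero, one_mul]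
    rfl
  refine ⟨LW, _, ∏ v ∈ S₀, uv v, hLW, hG₁, ?_⟩
  rw [Finset.prod_image hinj, map_mul, map_prod, Finset.prod_congr rfl key, Units.coe_prod, eulerFactorProduct_eq,
    map_mul, map_mul, map_prod, map_prod]
  simp only [map_mul]
  rw [Finset.prod_mul_distrib]
  ring

/-- **The `χ`-twisted tame `2`-adic `L`-function vs `L₂(E) · ∏ 𝒫_ℓ`, modulo `2`** — the character half
(`exists_iwasawa_pair_map_toZMod_eq_two`: `L₂(f,α,χ) ≡ L₂(f,α,𝟙_m)`, Matsuno L.3.2 at `2`) and the depletion half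
(`exists_iwasawa_padicLFunctionTame_one_congr_two`: `L₂(f,α,𝟙_m) ≡ u·L₂(f,α)·∏𝒫_v`, Matsuno L.3.3) combined through the
uniqueness of integral lifts (`iwasawaToPowerSeries_injective`): for `E = W/ℚ` globally minimal, good ordinary at `2`, `f` its
newform, `ρ̄_{E,2}` irreducible, `S₀` a finite set of odd places of good reduction, `m = ∏_{v∈S₀} ℓ_v`, and `χ` an EVEN QUADRATIC
`ℚ₂`-valued character mod `m`: there are `L_W, G ∈ ℤ₂⟦T⟧`, `u ∈ ℤ₂⟦T⟧ˣ` with `ι L_W = L₂(f,α)`, `ι G = L₂(f,α,χ)` and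
`G ≡ u · L_W · ∏_{v∈S₀} 𝒫_v (mod 2)`. With the Birch identification `L₂(f_{E^{(d)}}) = unit·C(c)·L₂(f,α,χ_d)` (road P4) this is the
congruence `hcong` of the cell's Kida door. [cite: Matsuno2000, Lemmas 3.2–3.3 and proof of Theorem 3.1 (pp. 87–88)] -/
theorem exists_iwasawa_padicLFunctionTame_congr_two (hord : IsOrdinaryAt W 2) (hf : IsNewformOf W f)
    (hirr : W.HasIrreducibleModPGaloisRep 2) (S₀ : Finset (HeightOneSpectrum (𝓞 ℚ)))
    (hS2 : ∀ v ∈ S₀, Rat.HeightOneSpectrum.natGenerator v ≠ 2) (hgood : ∀ v ∈ S₀, W.HasGoodReductionAt v)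
    {m : ℕ} [NeZero m] (hm : m = ∏ v ∈ S₀, Rat.HeightOneSpectrum.natGenerator v)
    (χ : DirichletCharacter ℚ_[2] m) (hχ : χ.Even) (hsq : χ ^ 2 = 1) :
    ∃ (LW G : IwasawaAlgebra 2) (u : (IwasawaAlgebra 2)ˣ),
      iwasawaToPowerSeries 2 LW = padicLFunction f (unitRoot W 2 : ℚ_[2]) ∧
      iwasawaToPowerSeries 2 G = padicLFunctionTame f m (unitRoot W 2 : ℚ_[2]) χ ∧
      PowerSeries.map (PadicInt.toZMod (p := 2)) G =
        PowerSeries.map (PadicInt.toZMod (p := 2)) ((u : IwasawaAlgebra 2) * LW * eulerFactorProduct W 2 S₀) := by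
  have hprime : ∀ v : HeightOneSpectrum (𝓞 ℚ), (Rat.HeightOneSpectrum.natGenerator v).Prime := fun v ↦
    (Rat.HeightOneSpectrum.primesEquiv v).2
  have hm2 : m.Coprime 2 := by
    rw [hm]
    exact Nat.Coprime.prod_left fun v hv ↦ (Nat.coprime_primes (hprime v) Nat.prime_two).mpr (hS2 v hv)
  have hmN : m.Coprime N := by
    rw [hm]
    refine Nat.Coprime.prod_left fun v hv ↦ ?_
    haveI : Fact (Rat.HeightOneSpectrum.natGenerator v).Prime := ⟨hprime v⟩
    have hgp : W.HasGoodReductionAtPrime (Rat.HeightOneSpectrum.natGenerator v) :=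
      (hasGoodReductionAtPrime_iff_hasGoodReductionAt_ringOfIntegers v W).mpr (hgood v hv)
    exact (Nat.Prime.coprime_iff_not_dvd (hprime v)).mpr (not_dvd_level_of_isNewformOf hf hgp)
  obtain ⟨G, G₁, hG, hG₁, hGG₁⟩ := exists_iwasawa_pair_map_toZMod_eq_two hord hf hirr hm2 hmN χ hχ hsq
  obtain ⟨LW, G₁', u, hLW, hG₁', hcongr⟩ := exists_iwasawa_padicLFunctionTame_one_congr_two hord hf hirr S₀ hS2 hgood hm
  have hEq : G₁ = G₁' := iwasawaToPowerSeries_injective 2 (hG₁.trans hG₁'.symm)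
  exact ⟨LW, G, u, hLW, hG, by rw [hGG₁, hEq, hcongr]⟩

end DepletionAtTwo

end Literature.NumberTheory.EllipticCurves

end
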